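import Summits.Ventures.LatticeQCDFlow.Scaling.SkipFreeCountFloor
import Summits.Ventures.LatticeQCDFlow.Scaling.SwapGraphDilution
import Summits.Ventures.LatticeQCDFlow.Scaling.HubAcceptanceLaw

/-!
HONEST FRAMING: exact (Metropolis-corrected) sampling algorithms for lattice gauge theory; figures
of merit are autocorrelation/cost numbers at stated couplings and volumes; no continuum-physics
claim.

# TightSectorKLogKFloor — THE `log K` WITH THE MAP QUALITY: PLANT A CONFIGURATION OF A RARE SECTOR `A` IN EVERY COLD REPLICA; A REPLICA
# LOSES ITS LABEL ONLY THROUGH AN ACCEPTED HUB SWAP, AT RATE `≤ t·ĉ·p'·q'/m`, SO `P_x{no labelled replica at time n} ≤ (1 + t·ĉ·p'·q'/m)ⁿ/(K+1)`,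
# FOR EVERY HOT SAMPLER AND EVERY ALLOCATION OF THE UPDATES — THE EXTINCTION HALF OF THE `log K` FLOOR WITH THE QUALITY (lean-2 GEN-29, ours)

Venture-side (OURS).  Cell `lqcd-flow` (pub-lqcd), unit `pub-lqcd-lean-2-g29`, 2026-08-28.  Chapter O (the floor sees the map quality), file 7:
`Scaling/SkipFreeCountFloor` (O6) applied to the chapter-M/N scheme `P = t·GSw + (1−t)·Π_w^M` on the hub list `r ↦ (0, κ_r+1)` (every cold level
listed at most `ĉ` times) with entry maps `φ_r` preserving a sector `A`.  The count is `V(x) = #{k : x_{k+1} ∈ A}`, the number of cold replicas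
holding a configuration of `A`.  Swaps keep the full sector census, so `V` moves by at most one; a cold replica's own (sector-idle) update never
leaves `A`; and `V` DROPS only when a hub swap hands a replica holding `z ∈ A` the transported hot configuration `φ_r(x_0)` with `x_0 ∉ A` and is
ACCEPTED, which under POINTWISE tightness on `A` (`μ_0(φ_r⁻¹z) ≤ p'·μ_{κ_r+1}(z)`, `z ∈ A`) and the light-side ratio (`μ_{κ_r+1}(φ_r u) ≤ q'·μ_0(u)`,
`u ∉ A`) has Metropolis probability `≤ p'q'`.  Hence `λ = t·ĉ·p'·q'/m` in O6 — whatever the hot kernel `M_0` and the weights `w`.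

## What is proved

* `coldCount` lemmas: `labelCount_update_zero`, `labelCount_le_update_succ`, `labelCensus_eq`, `coldCount_swap_le`.
* **`tightSector_coldCount_drop_le`** — `Σ_{y : V(y) < V(x)} P(x,y) ≤ (t·ĉ·p'·q'/m)·V(x)`; `tightSector_coldCount_skipFree` — `P(x,y) ≠ 0 → V(x) ≤ V(y)+1`.
* **`tightSector_extinction_le`** — `P_x{V(X_n) = 0} ≤ (1 + tĉp'q'/m)ⁿ/(V(x)+1)`.
* The distance and mixing-time floors (`d(n) ≥ 1 − (1 + tĉp'q'/m)ⁿ/(K+1) − Kθ`, `t_mix(ε) ≥ (m/(t·ĉ·p'·q'))·log((K+1)(1−ε−Kθ))`) are assembled in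
  the sequel `Scaling/TightSectorKLogKLaw` (O8), together with the two-point witness.

Reading (no numerics implied): a planted rare label leaves a cold replica only through an ACCEPTED hub swap against a LIGHT hot configuration, so
`K` planted labels survive `(m/(t·ĉ·p'·q'))·log K` steps with probability bounded below — the extinction half of the `log K` floor with the quality,
turned into `d(n)` and `t_mix` floors in the sequel.  NOT CLAIMED: that the pointwise constants `p', q'` are small for lattice maps (`q' ≤ 1/p` always;
`q' ≤ 1`, `p' = p` on the two-point witness); the refresh budget's `(K/((1−t)w_0·p'))·log K` (a label pushed back from the hub into a light replica is
not followed by this count); anything measured.  Literature grade (cell rule): OWN RESULT (O6 + the census invariance of chapter K); nothing cited as a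
fact; no new bib keys.
-/

noncomputable section

open Finset Function
open Literature.Probability.MarkovChains

namespace Summit.Ventures.LatticeQCDFlow.Scaling

variable {S : Type*} [Fintype S] [DecidableEq S] {K m : ℕ} {μ : Fin (K + 1) → S → ℝ} {M : Fin (K + 1) → S → S → ℝ}
  {w : Fin (K + 1) → ℝ} {t p : ℝ}

/-! ## §1 The cold count -/

omit [Fintype S] in
/-- `V(x) = #{k : x_{k+1} ∈ A}` (the number of cold replicas holding a configuration of `A`) ignores the hot coordinate. [ours] -/
theorem labelCount_update_zero (A : Finset S) (x : Fin (K + 1) → S) (v : S) :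
    (univ.filter (fun k : Fin K => update x 0 v k.succ ∈ A)).card = (univ.filter (fun k : Fin K => x k.succ ∈ A)).card := by
  have h : ∀ k : Fin K, update x 0 v k.succ = x k.succ := fun k => update_of_ne (Fin.succ_ne_zero k) _ _
  simp_rw [h]

omit [Fintype S] in
/-- Updating one cold coordinate lowers the cold count by at most one. [ours] -/
theorem labelCount_le_update_succ (A : Finset S) (x : Fin (K + 1) → S) (j : Fin K) (v : S) :
    (univ.filter (fun k : Fin K => x k.succ ∈ A)).card ≤ (univ.filter (fun k : Fin K => update x j.succ v k.succ ∈ A)).card + 1 := by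
  have hsub : univ.filter (fun k : Fin K => x k.succ ∈ A)
      ⊆ insert j (univ.filter (fun k : Fin K => update x j.succ v k.succ ∈ A)) := by
    intro k hk
    rw [mem_insert]
    by_cases hkj : k = j
    · exact Or.inl hkj
    · refine Or.inr (mem_filter.mpr ⟨mem_univ _, ?_⟩)
      rw [update_of_ne (fun h => hkj (Fin.succ_injective _ h))]
      exact (mem_filter.mp hk).2
  exact (card_le_card hsub).trans (card_insert_le _ _)

omit [Fintype S] in
/-- The full census splits as hot indicator plus cold count: `Σ_i 𝟙{x_i ∈ A} = 𝟙{x_0 ∈ A} + V(x)`. [ours] -/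
theorem labelCensus_eq (A : Finset S) (x : Fin (K + 1) → S) :
    ∑ i : Fin (K + 1), (if x i ∈ A then (1 : ℝ) else 0)
      = (if x 0 ∈ A then (1 : ℝ) else 0) + ((univ.filter (fun k : Fin K => x k.succ ∈ A)).card : ℝ) := by
  rw [Fin.sum_univ_succ, Finset.sum_boole]

/-! ## §2 The count is skip-free and drops at rate `≤ t·ĉ·p'·q'/m` -/

section Star
variable (κ : Fin m → Fin K) (φ : Fin m → Equiv.Perm S)

/-- **`P(x,y) ≠ 0 → V(x) ≤ V(y) + 1`:** swaps keep the full census (chapter K), updates move one coordinate. [ours] -/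
theorem tightSector_coldCount_skipFree (hμ : ∀ k x, 0 < μ k x) {A : Finset S}
    (hφA : ∀ r u, φ r u ∈ A ↔ u ∈ A) (x y : Fin (K + 1) → S)
    (hxy : t * ptGraphSwap μ (fun r : Fin m => (((0 : Fin (K + 1)), (κ r).succ) : Fin (K + 1) × Fin (K + 1))) φ x y
      + (1 - t) * prodKernel w M x y ≠ 0) :
    (univ.filter (fun k : Fin K => x k.succ ∈ A)).card ≤ (univ.filter (fun k : Fin K => y k.succ ∈ A)).card + 1 := by
  have he : ∀ r : Fin m, ((fun r : Fin m => (((0 : Fin (K + 1)), (κ r).succ) : Fin (K + 1) × Fin (K + 1))) r).1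
      ≠ ((fun r : Fin m => (((0 : Fin (K + 1)), (κ r).succ) : Fin (K + 1) × Fin (K + 1))) r).2 :=
    fun r => (Fin.succ_ne_zero (κ r)).symm
  by_cases hsw : ptGraphSwap μ (fun r : Fin m => (((0 : Fin (K + 1)), (κ r).succ) : Fin (K + 1) × Fin (K + 1))) φ x y ≠ 0
  · -- the full census is preserved
    have hcount := ptGraphSwap_sectorCount_eq he hμ hφA x y hsw
    rw [labelCensus_eq, labelCensus_eq] at hcount
    have h1 : ((univ.filter (fun k : Fin K => x k.succ ∈ A)).card : ℝ)
        ≤ ((univ.filter (fun k : Fin K => y k.succ ∈ A)).card : ℝ) + 1 := by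
      have ha : (0 : ℝ) ≤ (if x 0 ∈ A then (1 : ℝ) else 0) := by split_ifs <;> norm_num
      have hb : (if y 0 ∈ A then (1 : ℝ) else 0) ≤ 1 := by split_ifs <;> norm_num
      linarith
    exact_mod_cast h1
  · -- then the product part is non-zero: one coordinate moved
    rw [not_ne_iff] at hsw
    rw [hsw, mul_zero, zero_add] at hxy
    have hprod : prodKernel w M x y ≠ 0 := fun h => hxy (by rw [h, mul_zero])
    rw [prodKernel_apply] at hprod
    obtain ⟨j, -, hj⟩ := Finset.exists_ne_zero_of_sum_ne_zero hprod
    have hcoord : coordKernel M j x y ≠ 0 := fun h => hj (by rw [h, mul_zero])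
    have hyupd : y = update x j (y j) := by
      unfold coordKernel at hcoord
      by_contra h
      exact hcoord (if_neg h)
    rw [hyupd]
    cases j using Fin.cases with
    | zero => rw [labelCount_update_zero]; exact Nat.le_succ _
    | succ j => exact labelCount_le_update_succ A x j (y j.succ)

/-- **THE DROP RATE:** pointwise tightness on `A`, light-side ratio `q'`, `A`-preserving maps, sector-idle cold kernels (`w_k·Q_k(A,Aᶜ) = 0`),
multiplicities `≤ ĉ`, `0 ≤ t ≤ 1`, `p', q' ≥ 0`: **`Σ_{y : V(y) < V(x)} P(x,y) ≤ (t·ĉ·p'·q'/m)·V(x)`**. [ours] -/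
theorem tightSector_coldCount_drop_le (hm : 1 ≤ m) (hμ : ∀ k x, 0 < μ k x) (hM : ∀ k, IsRowStochastic (M k))
    (ht0 : 0 ≤ t) {A : Finset S} (hφA : ∀ r u, φ r u ∈ A ↔ u ∈ A) {p' q' : ℝ} (hp' : 0 ≤ p') (hq' : 0 ≤ q')
    (htight : ∀ r, ∀ z ∈ A, μ 0 ((φ r).symm z) ≤ p' * μ (κ r).succ z)
    (hlight : ∀ r, ∀ u ∉ A, μ (κ r).succ (φ r u) ≤ q' * μ 0 u)
    (hidle : ∀ k : Fin (K + 1), k ≠ 0 → w k * edgeMeasure (μ k) (M k) A Aᶜ = 0)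
    {cmax : ℕ} (hc : ∀ k : Fin K, (univ.filter (fun r : Fin m => κ r = k)).card ≤ cmax) (x : Fin (K + 1) → S) :
    ∑ y ∈ univ.filter (fun y : Fin (K + 1) → S =>
        (univ.filter (fun k : Fin K => y k.succ ∈ A)).card < (univ.filter (fun k : Fin K => x k.succ ∈ A)).card),
      (t * ptGraphSwap μ (fun r : Fin m => (((0 : Fin (K + 1)), (κ r).succ) : Fin (K + 1) × Fin (K + 1))) φ x y
        + (1 - t) * prodKernel w M x y)
      ≤ t * cmax * p' * q' / m * ((univ.filter (fun k : Fin K => x k.succ ∈ A)).card : ℝ) := by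
  have hmpos : (0 : ℝ) < m := Nat.cast_pos.mpr (by omega)
  set e : Fin m → Fin (K + 1) × Fin (K + 1) := fun r => (((0 : Fin (K + 1)), (κ r).succ) : Fin (K + 1) × Fin (K + 1))
    with he_def
  have he : ∀ r, (e r).1 ≠ (e r).2 := fun r => (Fin.succ_ne_zero (κ r)).symm
  set V : (Fin (K + 1) → S) → ℕ := fun y => (univ.filter (fun k : Fin K => y k.succ ∈ A)).card with hV
  have hπ := tensorFun_pos hμ
  -- (i) the product part never lowers the count
  have hprod : ∑ y ∈ univ.filter (fun y : Fin (K + 1) → S => V y < V x), prodKernel w M x y = 0 := by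
    rw [Finset.sum_filter]
    have h := sum_prodKernel_mul (P := M) w x (fun y => if V y < V x then (1 : ℝ) else 0)
    simp_rw [mul_ite, mul_one, mul_zero] at h
    rw [h]
    refine Finset.sum_eq_zero fun j _ => ?_
    rw [mul_eq_zero]
    cases j using Fin.cases with
    | zero =>
      refine Or.inr (Finset.sum_eq_zero fun v _ => ?_)
      have : ¬ V (update x 0 v) < V x := by rw [hV]; simp only; rw [labelCount_update_zero]; exact lt_irrefl _
      rw [if_neg this]
    | succ j =>
      by_cases hwj : w j.succ = 0
      · exact Or.inl hwj
      · refine Or.inr (Finset.sum_eq_zero fun v _ => ?_)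
        by_cases hlt : V (update x j.succ v) < V x
        · -- then `x_{j+1} ∈ A` and `v ∉ A`: a sector-idle kernel puts no mass there
          rw [if_pos hlt]
          have hxj : x j.succ ∈ A := by
            by_contra hxj
            apply not_le.mpr hlt
            refine card_le_card fun k hk => mem_filter.mpr ⟨mem_univ _, ?_⟩
            have hk' := (mem_filter.mp hk).2
            by_cases hkj : k = j
            · subst hkj; exact absurd hk' (by exact hxj)
            · rw [update_of_ne (fun h => hkj (Fin.succ_injective _ h))]; exact hk'
          have hv : v ∉ A := by
            intro hv
            apply not_le.mpr hlt
            refine card_le_card fun k hk => mem_filter.mpr ⟨mem_univ _, ?_⟩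
            have hk' := (mem_filter.mp hk).2
            by_cases hkj : k = j
            · subst hkj; rw [update_self]; exact hv
            · rw [update_of_ne (fun h => hkj (Fin.succ_injective _ h))]; exact hk'
          -- from `w_k·Q_k(A,Aᶜ) = 0`: `w_k·μ_k(z)·M_k(z,v) = 0` for `z ∈ A`, `v ∉ A`
          have hQ := hidle j.succ (Fin.succ_ne_zero j)
          rw [mul_eq_zero] at hQ
          rcases hQ with hw | hQ
          · exact absurd hw hwj
          · unfold edgeMeasure at hQ
            have hterm := (Finset.sum_eq_zero_iff_of_nonneg (fun z _ => sum_nonneg fun v' _ =>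
              mul_nonneg (hμ _ z).le ((hM j.succ).1 z v'))).mp hQ (x j.succ) hxj
            have hterm' := (Finset.sum_eq_zero_iff_of_nonneg (fun v' _ => mul_nonneg (hμ _ _).le ((hM j.succ).1 _ v'))).mp hterm v
              (Finset.mem_compl.mpr hv)
            rcases mul_eq_zero.mp hterm' with h0 | h0
            · exact absurd h0 (hμ _ _).ne'
            · exact h0
        · rw [if_neg hlt]
  -- (ii) the swap part: only accepted crossings at labelled levels, each `≤ p'q'/m`
  have hswap : ∑ y ∈ univ.filter (fun y : Fin (K + 1) → S => V y < V x), ptGraphSwap μ e φ x y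
      ≤ cmax * p' * q' / m * (V x : ℝ) := by
    -- off-diagonal formula, summed over the filter
    have hoff : ∀ y, V y < V x → ptGraphSwap μ e φ x y
        = ∑ r : Fin m, (if y = edgeFlowSwap (φ r) (e r).1 (e r).2 x then (1 : ℝ) / m else 0)
            * min 1 (tensorFun μ y / tensorFun μ x) := by
      intro y hy
      have hyx : y ≠ x := fun h => (lt_irrefl _) (h ▸ hy)
      have h := tensorFun_mul_ptGraphSwap (e := e) (φ := φ) hμ he hyx
      have hπx := hπ x
      have e1 : ptGraphSwap μ e φ x y = ptGraphProposal e φ x y * min 1 (tensorFun μ y / tensorFun μ x) := by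
        have : min (tensorFun μ x) (tensorFun μ y) = tensorFun μ x * min 1 (tensorFun μ y / tensorFun μ x) := by
          rw [mul_min_of_nonneg _ _ hπx.le, mul_one, mul_div_cancel₀ _ hπx.ne']
        rw [this] at h
        field_simp at h
        linarith [h]
      rw [e1]
      unfold ptGraphProposal
      rw [Finset.sum_mul]
    rw [sum_congr rfl fun y hy => hoff y (mem_filter.mp hy).2]
    rw [Finset.sum_comm]
    -- each entry: at most one `y` (its swap), and only a labelled level with a light hub can drop
    have hentry : ∀ r : Fin m, ∑ y ∈ univ.filter (fun y : Fin (K + 1) → S => V y < V x),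
        (if y = edgeFlowSwap (φ r) (e r).1 (e r).2 x then (1 : ℝ) / m else 0) * min 1 (tensorFun μ y / tensorFun μ x)
        ≤ if x (κ r).succ ∈ A then p' * q' / m else 0 := by
      intro r
      rw [← Finset.sum_filter_add_sum_filter_not _ (fun y => y = edgeFlowSwap (φ r) (e r).1 (e r).2 x)]
      have hrest : ∑ y ∈ (univ.filter (fun y : Fin (K + 1) → S => V y < V x)).filter
          (fun y => ¬ y = edgeFlowSwap (φ r) (e r).1 (e r).2 x),
          (if y = edgeFlowSwap (φ r) (e r).1 (e r).2 x then (1 : ℝ) / m else 0) * min 1 (tensorFun μ y / tensorFun μ x) = 0 :=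
        Finset.sum_eq_zero fun y hy => by rw [if_neg (mem_filter.mp hy).2, zero_mul]
      rw [hrest, add_zero]
      set y₀ := edgeFlowSwap (φ r) (e r).1 (e r).2 x with hy₀
      have hsub : (univ.filter (fun y : Fin (K + 1) → S => V y < V x)).filter (fun y => y = y₀) ⊆ {y₀} := by
        intro y hy; rw [mem_singleton]; exact (mem_filter.mp hy).2
      have hnn : ∀ y ∈ ({y₀} : Finset (Fin (K + 1) → S)),
          0 ≤ (if y = y₀ then (1 : ℝ) / m else 0) * min 1 (tensorFun μ y / tensorFun μ x) := fun y _ =>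
        mul_nonneg (by split_ifs <;> positivity) (le_min zero_le_one (div_nonneg (hπ y).le (hπ x).le))
      by_cases hdrop : V y₀ < V x
      · -- the swap lowers the count: `x_{κ_r+1} ∈ A`, `x_0 ∉ A`, ratio `≤ p'q'`
        have hl : x (κ r).succ ∈ A := by
          by_contra hl
          apply not_le.mpr hdrop
          refine card_le_card fun k hk => mem_filter.mpr ⟨mem_univ _, ?_⟩
          have hk' := (mem_filter.mp hk).2
          by_cases hkr : k = κ r
          · subst hkr; exact absurd hk' hl
          · rw [hy₀, edgeFlowSwap_of_ne _ _ _ _ (Fin.succ_ne_zero k) (fun h => hkr (Fin.succ_injective _ h))]; exact hk'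
        have h0 : x 0 ∉ A := by
          intro h0
          apply not_le.mpr hdrop
          refine card_le_card fun k hk => mem_filter.mpr ⟨mem_univ _, ?_⟩
          have hk' := (mem_filter.mp hk).2
          by_cases hkr : k = κ r
          · subst hkr; rw [hy₀]; show edgeFlowSwap (φ r) 0 (κ r).succ x (κ r).succ ∈ A
            rw [edgeFlowSwap_snd]; exact (hφA r _).2 h0
          · rw [hy₀, edgeFlowSwap_of_ne _ _ _ _ (Fin.succ_ne_zero k) (fun h => hkr (Fin.succ_injective _ h))]; exact hk'
        rw [if_pos hl]
        refine (sum_le_sum_of_subset_of_nonneg hsub (fun y hy _ => hnn y hy)).trans ?_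
        rw [sum_singleton, if_pos rfl]
        -- the ratio
        have hratio : tensorFun μ y₀ / tensorFun μ x ≤ p' * q' := by
          rw [div_le_iff₀ (hπ x)]
          have hsw := tensorFun_edgeFlowSwap_mul μ (φ r) (he r) x
          -- `π̃(y₀)·μ_0(x_0)μ_l(x_l) = π̃(x)·μ_0(φ⁻¹x_l)μ_l(φx_0)`
          have hpos : 0 < μ 0 (x 0) * μ (κ r).succ (x (κ r).succ) := mul_pos (hμ _ _) (hμ _ _)
          have h1 := htight r _ hl
          have h2 := hlight r _ h0
          have hb : μ 0 ((φ r).symm (x (κ r).succ)) * μ (κ r).succ (φ r (x 0))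
              ≤ p' * q' * (μ 0 (x 0) * μ (κ r).succ (x (κ r).succ)) := by
            calc μ 0 ((φ r).symm (x (κ r).succ)) * μ (κ r).succ (φ r (x 0))
                ≤ (p' * μ (κ r).succ (x (κ r).succ)) * (q' * μ 0 (x 0)) :=
                  mul_le_mul h1 h2 (hμ _ _).le (mul_nonneg hp' (hμ _ _).le)
              _ = p' * q' * (μ 0 (x 0) * μ (κ r).succ (x (κ r).succ)) := by ring
          have key : tensorFun μ y₀ * (μ 0 (x 0) * μ (κ r).succ (x (κ r).succ))
              ≤ p' * q' * tensorFun μ x * (μ 0 (x 0) * μ (κ r).succ (x (κ r).succ)) := by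
            rw [hy₀]
            show tensorFun μ (edgeFlowSwap (φ r) 0 (κ r).succ x) * (μ 0 (x 0) * μ (κ r).succ (x (κ r).succ)) ≤ _
            rw [hsw]
            calc tensorFun μ x * (μ 0 ((φ r).symm (x (κ r).succ)) * μ (κ r).succ (φ r (x 0)))
                ≤ tensorFun μ x * (p' * q' * (μ 0 (x 0) * μ (κ r).succ (x (κ r).succ))) :=
                  mul_le_mul_of_nonneg_left hb (hπ x).le
              _ = _ := by ring
          exact le_of_mul_le_mul_right key hpos
        calc (1 : ℝ) / m * min 1 (tensorFun μ y₀ / tensorFun μ x) ≤ 1 / m * (p' * q') :=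
              mul_le_mul_of_nonneg_left ((min_le_right _ _).trans hratio) (by positivity)
          _ = p' * q' / m := by ring
      · -- the swap does not lower the count: the filter misses `y₀`
        have hemp : (univ.filter (fun y : Fin (K + 1) → S => V y < V x)).filter (fun y => y = y₀) = ∅ := by
          rw [Finset.filter_eq_empty_iff]
          intro y hy hyy
          exact hdrop (hyy ▸ (mem_filter.mp hy).2)
        rw [hemp, sum_empty]
        split_ifs <;> positivity
    refine (sum_le_sum fun r _ => hentry r).trans ?_
    -- count the labelled entries: `Σ_r 𝟙{x_{κ_r+1} ∈ A} ≤ ĉ·V(x)`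
    rw [Finset.sum_ite, Finset.sum_const_zero, add_zero, sum_const, nsmul_eq_mul]
    have hcount : ((univ.filter (fun r : Fin m => x (κ r).succ ∈ A)).card : ℝ) ≤ cmax * (V x : ℝ) := by
      have h : (univ.filter (fun r : Fin m => x (κ r).succ ∈ A)).card
          = ∑ k ∈ univ.filter (fun k : Fin K => x k.succ ∈ A), (univ.filter (fun r : Fin m => κ r = k)).card := by
        rw [← Finset.card_biUnion]
        · congr 1; ext r; simp [mem_biUnion, mem_filter]
        · intro k _ k' _ hkk'
          exact Finset.disjoint_filter.mpr fun r _ h h' => hkk' (h.symm.trans h')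
      have h2 : ∑ k ∈ univ.filter (fun k : Fin K => x k.succ ∈ A), (univ.filter (fun r : Fin m => κ r = k)).card
          ≤ ∑ k ∈ univ.filter (fun k : Fin K => x k.succ ∈ A), cmax := sum_le_sum fun k _ => hc k
      rw [sum_const, smul_eq_mul] at h2
      have : ((univ.filter (fun r : Fin m => x (κ r).succ ∈ A)).card : ℝ) ≤ ((V x * cmax : ℕ) : ℝ) := by
        exact_mod_cast h ▸ h2
      rw [Nat.cast_mul] at this
      linarith
    have hpq : 0 ≤ p' * q' / m := by positivity
    calc ((univ.filter (fun r : Fin m => x (κ r).succ ∈ A)).card : ℝ) * (p' * q' / m) ≤ cmax * (V x : ℝ) * (p' * q' / m) :=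
          mul_le_mul_of_nonneg_right hcount hpq
      _ = cmax * p' * q' / m * (V x : ℝ) := by ring
  -- assemble
  rw [Finset.sum_add_distrib, ← Finset.mul_sum, ← Finset.mul_sum, hprod, mul_zero, add_zero]
  calc t * ∑ y ∈ univ.filter (fun y : Fin (K + 1) → S => V y < V x), ptGraphSwap μ e φ x y
      ≤ t * (cmax * p' * q' / m * (V x : ℝ)) := mul_le_mul_of_nonneg_left hswap ht0
    _ = t * cmax * p' * q' / m * (V x : ℝ) := by ring

/-! ## §3 Extinction -/

/-- **`P_x{no labelled cold replica at time n} ≤ (1 + t·ĉ·p'·q'/m)ⁿ/(V(x)+1)`** (hypotheses of §2; `w` a probability vector, `0 ≤ t ≤ 1`). [ours] -/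
theorem tightSector_extinction_le (hm : 1 ≤ m) (hμ : ∀ k x, 0 < μ k x) (hM : ∀ k, IsRowStochastic (M k)) (hw0 : ∀ k, 0 ≤ w k)
    (hw1 : ∑ k, w k = 1) (ht0 : 0 ≤ t) (ht1 : t ≤ 1) {A : Finset S} (hφA : ∀ r u, φ r u ∈ A ↔ u ∈ A) {p' q' : ℝ} (hp' : 0 ≤ p')
    (hq' : 0 ≤ q') (htight : ∀ r, ∀ z ∈ A, μ 0 ((φ r).symm z) ≤ p' * μ (κ r).succ z)
    (hlight : ∀ r, ∀ u ∉ A, μ (κ r).succ (φ r u) ≤ q' * μ 0 u)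
    (hidle : ∀ k : Fin (K + 1), k ≠ 0 → w k * edgeMeasure (μ k) (M k) A Aᶜ = 0)
    {cmax : ℕ} (hc : ∀ k : Fin K, (univ.filter (fun r : Fin m => κ r = k)).card ≤ cmax) (n : ℕ) (x : Fin (K + 1) → S) :
    ∑ y ∈ univ.filter (fun y : Fin (K + 1) → S => (univ.filter (fun k : Fin K => y k.succ ∈ A)).card = 0),
        lawAt (fun a b : Fin (K + 1) → S =>
          t * ptGraphSwap μ (fun r : Fin m => (((0 : Fin (K + 1)), (κ r).succ) : Fin (K + 1) × Fin (K + 1))) φ a b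
            + (1 - t) * prodKernel w M a b) (Pi.single x 1) n y
      ≤ (1 + t * cmax * p' * q' / m) ^ n / (((univ.filter (fun k : Fin K => x k.succ ∈ A)).card : ℝ) + 1) := by
  have hmpos : (0 : ℝ) < m := Nat.cast_pos.mpr (by omega)
  have hP := weightedScheme_isRowStochastic (t := t) (w := w)
    (ptGraphSwap_isRowStochastic (e := fun r : Fin m => (((0 : Fin (K + 1)), (κ r).succ) : Fin (K + 1) × Fin (K + 1))) (φ := φ) hμ)
    hM hw0 hw1 ht0 ht1
  exact skipFree_extinction_le hP (fun y => (univ.filter (fun k : Fin K => y k.succ ∈ A)).card)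
    (fun a b hab => tightSector_coldCount_skipFree κ φ (M := M) hμ hφA a b hab) (by positivity)
    (fun a => tightSector_coldCount_drop_le κ φ hm hμ hM ht0 hφA hp' hq' htight hlight hidle hc a) n x

end Star

end Summit.Ventures.LatticeQCDFlow.Scaling

end
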